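import Mathlib.Analysis.Convex.Deriv
import Mathlib.Analysis.SpecialFunctions.Log.Deriv
import Mathlib.Analysis.SpecialFunctions.ExpDeriv
import Mathlib.Analysis.SpecialFunctions.Pow.Real
import HarnessLib

/-!
# Convexity of the pendant comparison function — a second (differential) proof that the port component of `(Q6)` survives pendant extension

Support file for crux `stmt-CriticalPhenomena-4575` (`NoHeavyLowerTail`), seat `prim-l12-p1` gen 22
(`--supports stmt-CriticalPhenomena-4575`; memo `run/shared/lean/prim/prim-l12/FROM-prim-l12-p1-g22-*.md`,
lead memo `FROM-prim-nh-lead-4575-g115-Q6-LAW-ALGEBRA.md` §6, INEQ-CLAIMS addendum 6 of 2026-08-23).  No definitions, no sorries, standard axioms.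
The statement `isoSexticPort_pendant'` below is the pendant lemma already in the tree as
`ThreePointIsoSexticPendant.isoSexticPort_pendant` (prim-facecert gen 19, power-series/sign-pattern proof); this file gives an independent
proof through a CONVEXITY theorem, which is slightly more than the star-shapedness proved there, and records the (trivial) stability of the
port component under terminal–terminal edges.

Cells of the partition law of three terminals `a, b, h` of a finite weighted graph: `x = P(abh)`, `s = P(ab|h)`, `t = P(ah|b)`,
`u = P(bh|a)`, `q = P(a|b|h)` (nonnegative, `q+s+t+u ≤ 1`); isolation coordinates `Q = q`, `I_a = q+u`, `I_b = q+t`, `I_h = q+s`.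
The PORT component of `(Q6)` at the port `h` is `Q⁶ ≤ I_a³·I_b³·I_h²`.  PENDANT EXTENSION of the port: a new vertex `w` is joined to `h`
by one edge open with probability `α` (or by any two-terminal network with `P(w ↔ h) = α`), and `w` becomes the new port; the new
isolation coordinates are `Q' = q + (1−α)(t+u)`, `I_a' = q+u+(1−α)t`, `I_b' = q+t+(1−α)u`, `I_w' = (1−α) + α(q+s)`.

* `convexOn_Phi` — for `a, b ≥ 0`, `a + b < 1` the function **`Φ(p) = (1−p(a+b))³ / ((1−pa)(1−pb))^{3/2}` is CONVEX on `[0,1]`**: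
  writing `Φ = exp φ`, `Φ'' = Φ·(φ'' + φ'²)` and (`phi_key`) `φ'' + φ'² = ¾(A−B)² + 3(X−S)(2X−S) ≥ 0` with `X = (a+b)/(1−p(a+b))`,
  `A = a/(1−pa)`, `B = b/(1−pb)`, `S = A+B ≤ X`.  (Without the constraint `d = a+b`, i.e. for `X < S`, convexity fails.)
* `Phi_le_chord` — hence `Φ(p) ≤ 1 − p + p·Φ(1)`;  `sextic_pendant_reduced` — if `(1−(a+b))⁶ ≤ (1−a)³(1−b)³(1−c)²`, i.e. `Φ(1) ≤ 1−c`,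
  then `Φ(p) ≤ 1 − pc`, i.e. `(1−p(a+b))⁶ ≤ (1−pa)³(1−pb)³(1−pc)²` for all `p ∈ [0,1]` (`sextic_pendant_hom`: homogeneous form;
  `sextic_pendant_degenerate`: the case `a+b = 1`).
* `isoSexticPort_pendant'` — the cell form: `q⁶ ≤ (q+u)³(q+t)³(q+s)² ⟹ Q'⁶ ≤ I_a'³·I_b'³·I_w'²`.
* `isoSexticPort_edge_ab/_ah` — a terminal–terminal edge scales `Q` and two of the `I_v` by the same factor, so the port component is
  also stable under terminal–terminal edges (the `E`-moves of `…CubicThreePointTerminalClosure`).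
With `ThreePointIsoSexticPendant.isoSexticPort_prod/_fan` (parallel composition, fans) and `ThreePointIsoSexticFace.face_half_of_isoSexticPort`
(`(Q6)_port ⟹ (C½)`): every gadget of the {parallel₃, pendant, fan, terminal-edge}-closure of the `(Q6)_port`-gadgets has `τ_face ≤ ½`.
-/

namespace Summit.CriticalPhenomena.PercolationContinuityZ3.Theorems.ThreePointIsoSexticPendantConvex

open Set Real

/-! ## Calculus: the comparison function `Φ = exp ∘ φ` and its two derivatives -/

/-- Derivative of `φ(p) = 3 log(1−p(a+b)) − 3/2 log(1−pa) − 3/2 log(1−pb)`. [this work] -/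
theorem hasDerivAt_phi {a b p : ℝ} (h1 : 1 - p * (a + b) ≠ 0) (h2 : 1 - p * a ≠ 0) (h3 : 1 - p * b ≠ 0) :
    HasDerivAt (fun p => 3 * log (1 - p * (a + b)) - 3 / 2 * log (1 - p * a) - 3 / 2 * log (1 - p * b))
      (3 * (-(a + b) / (1 - p * (a + b))) - 3 / 2 * (-a / (1 - p * a)) - 3 / 2 * (-b / (1 - p * b))) p := by
  have e1 : HasDerivAt (fun p => 1 - p * (a + b)) (-(a + b)) p := (hasDerivAt_mul_const (a + b)).const_sub 1
  have e2 : HasDerivAt (fun p => 1 - p * a) (-a) p := (hasDerivAt_mul_const a).const_sub 1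
  have e3 : HasDerivAt (fun p => 1 - p * b) (-b) p := (hasDerivAt_mul_const b).const_sub 1
  exact (((e1.log h1).const_mul 3).fun_sub ((e2.log h2).const_mul (3 / 2))).fun_sub ((e3.log h3).const_mul (3 / 2))

/-- Derivative of `φ'`. [this work] -/
theorem hasDerivAt_phi1 {a b p : ℝ} (h1 : 1 - p * (a + b) ≠ 0) (h2 : 1 - p * a ≠ 0) (h3 : 1 - p * b ≠ 0) :
    HasDerivAt (fun p => 3 * (-(a + b) / (1 - p * (a + b))) - 3 / 2 * (-a / (1 - p * a)) - 3 / 2 * (-b / (1 - p * b)))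
      (3 * (-(a + b) ^ 2 / (1 - p * (a + b)) ^ 2) - 3 / 2 * (-a ^ 2 / (1 - p * a) ^ 2)
        - 3 / 2 * (-b ^ 2 / (1 - p * b) ^ 2)) p := by
  have e1 : HasDerivAt (fun p => 1 - p * (a + b)) (-(a + b)) p := (hasDerivAt_mul_const (a + b)).const_sub 1
  have e2 : HasDerivAt (fun p => 1 - p * a) (-a) p := (hasDerivAt_mul_const a).const_sub 1
  have e3 : HasDerivAt (fun p => 1 - p * b) (-b) p := (hasDerivAt_mul_const b).const_sub 1
  have d1 : HasDerivAt (fun p => -(a + b) / (1 - p * (a + b))) (-(a + b) ^ 2 / (1 - p * (a + b)) ^ 2) p := by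
    have h0 := (hasDerivAt_const p (-(a + b))).fun_div e1 h1
    simp only [zero_mul, zero_sub] at h0
    refine h0.congr_deriv ?_
    ring
  have d2 : HasDerivAt (fun p => -a / (1 - p * a)) (-a ^ 2 / (1 - p * a) ^ 2) p := by
    have h0 := (hasDerivAt_const p (-a)).fun_div e2 h2
    simp only [zero_mul, zero_sub] at h0
    refine h0.congr_deriv ?_
    ring
  have d3 : HasDerivAt (fun p => -b / (1 - p * b)) (-b ^ 2 / (1 - p * b) ^ 2) p := by
    have h0 := (hasDerivAt_const p (-b)).fun_div e3 h3
    simp only [zero_mul, zero_sub] at h0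
    refine h0.congr_deriv ?_
    ring
  exact ((d1.const_mul 3).fun_sub (d2.const_mul (3 / 2))).fun_sub (d3.const_mul (3 / 2))

/-- The key identity and sign: `φ'' + φ'² = ¾(A−B)² + 3(X−S)(2X−S) ≥ 0` where `X = (a+b)/(1−p(a+b))`,
`A = a/(1−pa)`, `B = b/(1−pb)`, `S = A + B ≤ X`. [this work] -/
theorem phi_key {a b p : ℝ} (ha : 0 ≤ a) (hb : 0 ≤ b) (hp : 0 ≤ p) (h1 : 0 < 1 - p * (a + b)) :
    0 ≤ (3 * (-(a + b) / (1 - p * (a + b))) - 3 / 2 * (-a / (1 - p * a)) - 3 / 2 * (-b / (1 - p * b))) ^ 2 +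
      (3 * (-(a + b) ^ 2 / (1 - p * (a + b)) ^ 2) - 3 / 2 * (-a ^ 2 / (1 - p * a) ^ 2)
        - 3 / 2 * (-b ^ 2 / (1 - p * b) ^ 2)) := by
  have h2 : 0 < 1 - p * a := by nlinarith [mul_nonneg hp hb]
  have h3 : 0 < 1 - p * b := by nlinarith [mul_nonneg hp ha]
  set X : ℝ := (a + b) / (1 - p * (a + b)) with hX
  set A : ℝ := a / (1 - p * a) with hA
  set B : ℝ := b / (1 - p * b) with hB
  have eX : -(a + b) / (1 - p * (a + b)) = -X := by rw [hX, neg_div]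
  have eA : -a / (1 - p * a) = -A := by rw [hA, neg_div]
  have eB : -b / (1 - p * b) = -B := by rw [hB, neg_div]
  have eX2 : -(a + b) ^ 2 / (1 - p * (a + b)) ^ 2 = -X ^ 2 := by rw [hX, neg_div, div_pow]
  have eA2 : -a ^ 2 / (1 - p * a) ^ 2 = -A ^ 2 := by rw [hA, neg_div, div_pow]
  have eB2 : -b ^ 2 / (1 - p * b) ^ 2 = -B ^ 2 := by rw [hB, neg_div, div_pow]
  rw [eX, eA, eB, eX2, eA2, eB2]
  have hX0 : 0 ≤ X := div_nonneg (add_nonneg ha hb) h1.le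
  -- `A ≤ a/(1−p(a+b))`, `B ≤ b/(1−p(a+b))`, hence `A + B ≤ X`
  have hAle : A ≤ a / (1 - p * (a + b)) :=
    div_le_div_of_nonneg_left ha h1 (by nlinarith [mul_nonneg hp hb])
  have hBle : B ≤ b / (1 - p * (a + b)) :=
    div_le_div_of_nonneg_left hb h1 (by nlinarith [mul_nonneg hp ha])
  have hS : A + B ≤ X := by
    calc A + B ≤ a / (1 - p * (a + b)) + b / (1 - p * (a + b)) := add_le_add hAle hBle
      _ = X := by rw [hX, add_div]
  have key : (3 * -X - 3 / 2 * -A - 3 / 2 * -B) ^ 2 + (3 * -X ^ 2 - 3 / 2 * -A ^ 2 - 3 / 2 * -B ^ 2) =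
      3 / 4 * (A - B) ^ 2 + 3 * ((X - (A + B)) * (2 * X - (A + B))) := by ring
  rw [key]
  have h4 : 0 ≤ (X - (A + B)) * (2 * X - (A + B)) := mul_nonneg (by linarith) (by linarith)
  positivity

/-- **Convexity of `Φ(p) = (1−p(a+b))³/((1−pa)(1−pb))^{3/2}` on `[0,1]`** (for `a, b ≥ 0`, `a + b < 1`), written as
`Φ = exp ∘ φ`. [this work] -/
theorem convexOn_Phi {a b : ℝ} (ha : 0 ≤ a) (hb : 0 ≤ b) (hab : a + b < 1) :
    ConvexOn ℝ (Icc (0 : ℝ) 1)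
      (fun p => exp (3 * log (1 - p * (a + b)) - 3 / 2 * log (1 - p * a) - 3 / 2 * log (1 - p * b))) := by
  -- positivity of the three affine factors on `[0,1]`
  have pos : ∀ p ∈ Icc (0 : ℝ) 1, 0 < 1 - p * (a + b) ∧ 0 < 1 - p * a ∧ 0 < 1 - p * b := by
    intro p hp
    obtain ⟨hp0, hp1⟩ := hp
    refine ⟨?_, ?_, ?_⟩
    · nlinarith [mul_nonneg hp0 (add_nonneg ha hb)]
    · nlinarith [mul_nonneg hp0 ha, mul_nonneg hp0 hb]
    · nlinarith [mul_nonneg hp0 ha, mul_nonneg hp0 hb]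
  refine convexOn_of_hasDerivWithinAt2_nonneg (convex_Icc 0 1)
    (f' := fun p => exp (3 * log (1 - p * (a + b)) - 3 / 2 * log (1 - p * a) - 3 / 2 * log (1 - p * b)) *
      (3 * (-(a + b) / (1 - p * (a + b))) - 3 / 2 * (-a / (1 - p * a)) - 3 / 2 * (-b / (1 - p * b))))
    (f'' := fun p => exp (3 * log (1 - p * (a + b)) - 3 / 2 * log (1 - p * a) - 3 / 2 * log (1 - p * b)) *
      (3 * (-(a + b) / (1 - p * (a + b))) - 3 / 2 * (-a / (1 - p * a)) - 3 / 2 * (-b / (1 - p * b))) *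
      (3 * (-(a + b) / (1 - p * (a + b))) - 3 / 2 * (-a / (1 - p * a)) - 3 / 2 * (-b / (1 - p * b))) +
      exp (3 * log (1 - p * (a + b)) - 3 / 2 * log (1 - p * a) - 3 / 2 * log (1 - p * b)) *
      (3 * (-(a + b) ^ 2 / (1 - p * (a + b)) ^ 2) - 3 / 2 * (-a ^ 2 / (1 - p * a) ^ 2)
        - 3 / 2 * (-b ^ 2 / (1 - p * b) ^ 2)))
    ?_ ?_ ?_ ?_
  · intro p hp
    obtain ⟨h1, h2, h3⟩ := pos p hp
    exact ((hasDerivAt_phi h1.ne' h2.ne' h3.ne').exp).continuousAt.continuousWithinAt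
  · intro p hp
    rw [interior_Icc] at hp
    obtain ⟨h1, h2, h3⟩ := pos p (Ioo_subset_Icc_self hp)
    exact ((hasDerivAt_phi h1.ne' h2.ne' h3.ne').exp).hasDerivWithinAt
  · intro p hp
    rw [interior_Icc] at hp
    obtain ⟨h1, h2, h3⟩ := pos p (Ioo_subset_Icc_self hp)
    exact (((hasDerivAt_phi h1.ne' h2.ne' h3.ne').exp).fun_mul (hasDerivAt_phi1 h1.ne' h2.ne' h3.ne')).hasDerivWithinAt
  · intro p hp
    rw [interior_Icc] at hp
    obtain ⟨h1, h2, h3⟩ := pos p (Ioo_subset_Icc_self hp)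
    have hk := phi_key ha hb hp.1.le h1
    set E := exp (3 * log (1 - p * (a + b)) - 3 / 2 * log (1 - p * a) - 3 / 2 * log (1 - p * b)) with hEdef
    set F1 := 3 * (-(a + b) / (1 - p * (a + b))) - 3 / 2 * (-a / (1 - p * a)) - 3 / 2 * (-b / (1 - p * b)) with hF1
    set F2 := 3 * (-(a + b) ^ 2 / (1 - p * (a + b)) ^ 2) - 3 / 2 * (-a ^ 2 / (1 - p * a) ^ 2)
        - 3 / 2 * (-b ^ 2 / (1 - p * b) ^ 2) with hF2
    have hE : 0 ≤ E := (exp_pos _).le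
    have e : E * F1 * F1 + E * F2 = E * (F1 ^ 2 + F2) := by ring
    rw [e]
    exact mul_nonneg hE hk

/-- The square of `Φ` is the rational function `(1−p(a+b))⁶ / ((1−pa)³(1−pb)³)`. [this work] -/
theorem Phi_sq {a b p : ℝ} (h1 : 0 < 1 - p * (a + b)) (h2 : 0 < 1 - p * a) (h3 : 0 < 1 - p * b) :
    exp (3 * log (1 - p * (a + b)) - 3 / 2 * log (1 - p * a) - 3 / 2 * log (1 - p * b)) ^ 2 =
      (1 - p * (a + b)) ^ 6 / ((1 - p * a) ^ 3 * (1 - p * b) ^ 3) := by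
  rw [← exp_nat_mul]
  have e : ((2 : ℕ) : ℝ) * (3 * log (1 - p * (a + b)) - 3 / 2 * log (1 - p * a) - 3 / 2 * log (1 - p * b)) =
      ((6 : ℕ) : ℝ) * log (1 - p * (a + b)) - (((3 : ℕ) : ℝ) * log (1 - p * a) + ((3 : ℕ) : ℝ) * log (1 - p * b)) := by
    push_cast; ring
  rw [e, exp_sub, exp_add, exp_nat_mul, exp_nat_mul, exp_nat_mul, exp_log h1, exp_log h2, exp_log h3]

/-- **Chord inequality**: `Φ(p) ≤ 1 − p + p·Φ(1)` on `[0,1]`. [this work] -/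
theorem Phi_le_chord {a b p : ℝ} (ha : 0 ≤ a) (hb : 0 ≤ b) (hab : a + b < 1) (hp0 : 0 ≤ p) (hp1 : p ≤ 1) :
    exp (3 * log (1 - p * (a + b)) - 3 / 2 * log (1 - p * a) - 3 / 2 * log (1 - p * b)) ≤
      1 - p + p * exp (3 * log (1 - 1 * (a + b)) - 3 / 2 * log (1 - 1 * a) - 3 / 2 * log (1 - 1 * b)) := by
  have hc := (convexOn_Phi ha hb hab).2 (left_mem_Icc.2 zero_le_one) (right_mem_Icc.2 zero_le_one)
    (sub_nonneg.2 hp1) hp0 (sub_add_cancel 1 p)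
  simp only [smul_eq_mul, mul_zero, mul_one, zero_add, zero_mul, sub_zero, log_one] at hc
  simpa using hc

/-! ## The pendant lemma -/

/-- **Reduced form.**  For `a, b ≥ 0` with `a + b < 1`, `c ∈ [0,1]`: if `(1−(a+b))⁶ ≤ (1−a)³(1−b)³(1−c)²` then
`(1−p(a+b))⁶ ≤ (1−pa)³(1−pb)³(1−pc)²` for every `p ∈ [0,1]`. [this work] -/
theorem sextic_pendant_reduced {a b c p : ℝ} (ha : 0 ≤ a) (hb : 0 ≤ b) (hab : a + b < 1) (hc0 : 0 ≤ c) (hc1 : c ≤ 1)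
    (hp0 : 0 ≤ p) (hp1 : p ≤ 1) (H : (1 - (a + b)) ^ 6 ≤ (1 - a) ^ 3 * (1 - b) ^ 3 * (1 - c) ^ 2) :
    (1 - p * (a + b)) ^ 6 ≤ (1 - p * a) ^ 3 * (1 - p * b) ^ 3 * (1 - p * c) ^ 2 := by
  have h1 : 0 < 1 - p * (a + b) := by nlinarith [mul_nonneg hp0 (add_nonneg ha hb)]
  have h2 : 0 < 1 - p * a := by nlinarith [mul_nonneg hp0 ha, mul_nonneg hp0 hb]
  have h3 : 0 < 1 - p * b := by nlinarith [mul_nonneg hp0 ha, mul_nonneg hp0 hb]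
  have g1 : 0 < 1 - 1 * (a + b) := by linarith
  have g2 : 0 < 1 - 1 * a := by linarith
  have g3 : 0 < 1 - 1 * b := by linarith
  set F1 := exp (3 * log (1 - 1 * (a + b)) - 3 / 2 * log (1 - 1 * a) - 3 / 2 * log (1 - 1 * b)) with hF1
  set Fp := exp (3 * log (1 - p * (a + b)) - 3 / 2 * log (1 - p * a) - 3 / 2 * log (1 - p * b)) with hFp
  have hF1sq : F1 ^ 2 = (1 - 1 * (a + b)) ^ 6 / ((1 - 1 * a) ^ 3 * (1 - 1 * b) ^ 3) := Phi_sq g1 g2 g3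
  have hFpsq : Fp ^ 2 = (1 - p * (a + b)) ^ 6 / ((1 - p * a) ^ 3 * (1 - p * b) ^ 3) := Phi_sq h1 h2 h3
  -- `Φ(1) ≤ 1 − c`
  have hD1 : 0 < (1 - 1 * a) ^ 3 * (1 - 1 * b) ^ 3 := mul_pos (pow_pos g2 3) (pow_pos g3 3)
  have hF1c : F1 ^ 2 ≤ (1 - c) ^ 2 := by
    rw [hF1sq, div_le_iff₀ hD1]
    calc (1 - 1 * (a + b)) ^ 6 = (1 - (a + b)) ^ 6 := by ring
      _ ≤ (1 - a) ^ 3 * (1 - b) ^ 3 * (1 - c) ^ 2 := H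
      _ = (1 - c) ^ 2 * ((1 - 1 * a) ^ 3 * (1 - 1 * b) ^ 3) := by ring
  have hF1le : F1 ≤ 1 - c := (pow_le_pow_iff_left₀ (exp_pos _).le (sub_nonneg.2 hc1) two_ne_zero).1 hF1c
  -- chord: `Φ(p) ≤ 1 − p + pΦ(1) ≤ 1 − pc`
  have hchord : Fp ≤ 1 - p + p * F1 := Phi_le_chord ha hb hab hp0 hp1
  have hFple : Fp ≤ 1 - p * c := by nlinarith [mul_le_mul_of_nonneg_left hF1le hp0]
  have hpc : 0 ≤ 1 - p * c := by nlinarith [mul_le_mul hp1 hc1 hc0 zero_le_one]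
  have hsq : Fp ^ 2 ≤ (1 - p * c) ^ 2 := pow_le_pow_left₀ (exp_pos _).le hFple 2
  have hDp : 0 < (1 - p * a) ^ 3 * (1 - p * b) ^ 3 := mul_pos (pow_pos h2 3) (pow_pos h3 3)
  rw [hFpsq, div_le_iff₀ hDp] at hsq
  linarith [hsq]

/-- The degenerate case `q = 0` (`a + b = 1`): `(1−p)⁶ ≤ (1−pa)³(1−pb)³(1−pc)²`. [this work] -/
theorem sextic_pendant_degenerate {a b c p : ℝ} (ha : 0 ≤ a) (hb : 0 ≤ b) (hab : a + b = 1) (hc1 : c ≤ 1)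
    (hp0 : 0 ≤ p) (hp1 : p ≤ 1) :
    (1 - p * (a + b)) ^ 6 ≤ (1 - p * a) ^ 3 * (1 - p * b) ^ 3 * (1 - p * c) ^ 2 := by
  rw [hab, mul_one]
  have h2 : 0 ≤ 1 - p * a := by nlinarith [mul_nonneg hp0 ha, mul_nonneg hp0 hb]
  have h3 : 0 ≤ 1 - p * b := by nlinarith [mul_nonneg hp0 ha, mul_nonneg hp0 hb]
  have hq : 0 ≤ 1 - p := sub_nonneg.2 hp1
  -- `(1−pa)(1−pb) ≥ 1−p` and `1 − pc ≥ 1 − p`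
  have hM : 1 - p ≤ (1 - p * a) * (1 - p * b) := by nlinarith [mul_nonneg (mul_nonneg hp0 hp0) (mul_nonneg ha hb)]
  have hC : 1 - p ≤ 1 - p * c := by nlinarith [mul_le_mul_of_nonneg_left hc1 hp0]
  have hM3 : (1 - p) ^ 3 ≤ ((1 - p * a) * (1 - p * b)) ^ 3 := pow_le_pow_left₀ hq hM 3
  have hC2 : (1 - p) ^ 2 ≤ (1 - p * c) ^ 2 := pow_le_pow_left₀ hq hC 2
  have h5 : (1 - p) ^ 6 ≤ (1 - p) ^ 5 := by
    have : (1 - p) ^ 6 = (1 - p) ^ 5 * (1 - p) := by ring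
    rw [this]
    exact mul_le_of_le_one_right (pow_nonneg hq 5) (by linarith)
  calc (1 - p) ^ 6 ≤ (1 - p) ^ 5 := h5
    _ = (1 - p) ^ 3 * (1 - p) ^ 2 := by ring
    _ ≤ ((1 - p * a) * (1 - p * b)) ^ 3 * (1 - p * c) ^ 2 :=
        mul_le_mul hM3 hC2 (pow_nonneg hq 2) (pow_nonneg (mul_nonneg h2 h3) 3)
    _ = (1 - p * a) ^ 3 * (1 - p * b) ^ 3 * (1 - p * c) ^ 2 := by ring

/-- Homogeneous form of `sextic_pendant_reduced`/`_degenerate`: scale `z > 0`, `0 ≤ A, B`, `A + B ≤ z`. [this work] -/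
theorem sextic_pendant_hom {z A B c p : ℝ} (hz : 0 < z) (hA : 0 ≤ A) (hB : 0 ≤ B) (hABz : A + B ≤ z)
    (hc0 : 0 ≤ c) (hc1 : c ≤ 1) (hp0 : 0 ≤ p) (hp1 : p ≤ 1)
    (H : (z - (A + B)) ^ 6 ≤ (z - A) ^ 3 * (z - B) ^ 3 * (1 - c) ^ 2) :
    (z - p * (A + B)) ^ 6 ≤ (z - p * A) ^ 3 * (z - p * B) ^ 3 * (1 - p * c) ^ 2 := by
  have hz' : z ≠ 0 := hz.ne'
  have ha : 0 ≤ A / z := div_nonneg hA hz.le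
  have hb : 0 ≤ B / z := div_nonneg hB hz.le
  have hab1 : A / z + B / z ≤ 1 := by rwa [← add_div, div_le_one hz]
  -- identities `z · (reduced coordinate) = homogeneous coordinate`
  have i0 : z * (1 - (A / z + B / z)) = z - (A + B) := by
    have e : z * (1 - (A / z + B / z)) = z - (A / z * z + B / z * z) := by ring
    rw [e, div_mul_cancel₀ A hz', div_mul_cancel₀ B hz']
  have iA : z * (1 - A / z) = z - A := by
    have e : z * (1 - A / z) = z - A / z * z := by ring
    rw [e, div_mul_cancel₀ A hz']
  have iB : z * (1 - B / z) = z - B := by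
    have e : z * (1 - B / z) = z - B / z * z := by ring
    rw [e, div_mul_cancel₀ B hz']
  have j0 : z * (1 - p * (A / z + B / z)) = z - p * (A + B) := by
    have e : z * (1 - p * (A / z + B / z)) = z - p * (A / z * z + B / z * z) := by ring
    rw [e, div_mul_cancel₀ A hz', div_mul_cancel₀ B hz']
  have jA : z * (1 - p * (A / z)) = z - p * A := by
    have e : z * (1 - p * (A / z)) = z - p * (A / z * z) := by ring
    rw [e, div_mul_cancel₀ A hz']
  have jB : z * (1 - p * (B / z)) = z - p * B := by
    have e : z * (1 - p * (B / z)) = z - p * (B / z * z) := by ring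
    rw [e, div_mul_cancel₀ B hz']
  have hz6 : 0 < z ^ 6 := pow_pos hz 6
  have main : (1 - p * (A / z + B / z)) ^ 6 ≤ (1 - p * (A / z)) ^ 3 * (1 - p * (B / z)) ^ 3 * (1 - p * c) ^ 2 := by
    rcases eq_or_lt_of_le hab1 with hab | hab
    · exact sextic_pendant_degenerate ha hb hab hc1 hp0 hp1
    · refine sextic_pendant_reduced ha hb hab hc0 hc1 hp0 hp1 ?_
      -- the hypothesis `H` divided by `z⁶`
      have H' : z ^ 6 * (1 - (A / z + B / z)) ^ 6 ≤ z ^ 6 * ((1 - A / z) ^ 3 * (1 - B / z) ^ 3 * (1 - c) ^ 2) := by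
        calc z ^ 6 * (1 - (A / z + B / z)) ^ 6 = (z * (1 - (A / z + B / z))) ^ 6 := by ring
          _ = (z - (A + B)) ^ 6 := by rw [i0]
          _ ≤ (z - A) ^ 3 * (z - B) ^ 3 * (1 - c) ^ 2 := H
          _ = (z * (1 - A / z)) ^ 3 * (z * (1 - B / z)) ^ 3 * (1 - c) ^ 2 := by rw [iA, iB]
          _ = z ^ 6 * ((1 - A / z) ^ 3 * (1 - B / z) ^ 3 * (1 - c) ^ 2) := by ring
      exact (mul_le_mul_iff_right₀ hz6).1 H'
  calc (z - p * (A + B)) ^ 6 = (z * (1 - p * (A / z + B / z))) ^ 6 := by rw [j0]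
    _ = z ^ 6 * (1 - p * (A / z + B / z)) ^ 6 := by ring
    _ ≤ z ^ 6 * ((1 - p * (A / z)) ^ 3 * (1 - p * (B / z)) ^ 3 * (1 - p * c) ^ 2) :=
        mul_le_mul_of_nonneg_left main hz6.le
    _ = (z * (1 - p * (A / z))) ^ 3 * (z * (1 - p * (B / z))) ^ 3 * (1 - p * c) ^ 2 := by ring
    _ = (z - p * A) ^ 3 * (z - p * B) ^ 3 * (1 - p * c) ^ 2 := by rw [jA, jB]

/-- **The pendant lemma (port component of `(Q6)`), cell form** — the statement of
`ThreePointIsoSexticPendant.isoSexticPort_pendant` (prim-facecert), here derived from the convexity of `Φ`.  For nonnegative cells `q, s, t, u` with `q+s+t+u ≤ 1`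
(`x = 1−q−s−t−u`) of the law of `(a, b; h)` and every `α ∈ [0,1]`: if `q⁶ ≤ (q+u)³(q+t)³(q+s)²` (`(Q6)` at the port `h`), then the
pendant extension of the port with contact probability `α` satisfies `(Q6)` at its port `w`:
`(q + (1−α)(t+u))⁶ ≤ (q+u+(1−α)t)³ · (q+t+(1−α)u)³ · ((1−α) + α(q+s))²`. [this work] -/
theorem isoSexticPort_pendant' {q s t u α : ℝ} (hq : 0 ≤ q) (hs : 0 ≤ s) (ht : 0 ≤ t) (hu : 0 ≤ u)
    (hsum : q + s + t + u ≤ 1) (hα0 : 0 ≤ α) (hα1 : α ≤ 1) (h6 : q ^ 6 ≤ (q + u) ^ 3 * (q + t) ^ 3 * (q + s) ^ 2) :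
    (q + (1 - α) * (t + u)) ^ 6 ≤
      (q + u + (1 - α) * t) ^ 3 * (q + t + (1 - α) * u) ^ 3 * ((1 - α) + α * (q + s)) ^ 2 := by
  rcases eq_or_lt_of_le (add_nonneg (add_nonneg hq ht) hu : (0 : ℝ) ≤ q + t + u) with hz0 | hzpos
  · -- `q = t = u = 0`: the left-hand side vanishes
    have hq0 : q = 0 := by linarith
    have ht0 : t = 0 := by linarith
    have hu0 : u = 0 := by linarith
    rw [hq0, ht0, hu0]
    simp
  have H : (q + t + u - (t + u)) ^ 6 ≤ (q + t + u - t) ^ 3 * (q + t + u - u) ^ 3 * (1 - (1 - q - s)) ^ 2 := by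
    have e1 : q + t + u - (t + u) = q := by ring
    have e2 : q + t + u - t = q + u := by ring
    have e3 : q + t + u - u = q + t := by ring
    have e4 : 1 - (1 - q - s) = q + s := by ring
    rw [e1, e2, e3, e4]
    exact h6
  have key := sextic_pendant_hom hzpos ht hu (by linarith) (by linarith) (by linarith) hα0 hα1 H
  calc (q + (1 - α) * (t + u)) ^ 6 = (q + t + u - α * (t + u)) ^ 6 := by ring
    _ ≤ (q + t + u - α * t) ^ 3 * (q + t + u - α * u) ^ 3 * (1 - α * (1 - q - s)) ^ 2 := key
    _ = (q + u + (1 - α) * t) ^ 3 * (q + t + (1 - α) * u) ^ 3 * ((1 - α) + α * (q + s)) ^ 2 := by ring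

/-! ## Terminal–terminal edges (trivial) -/

/-- A terminal–terminal edge of probability `l` between the two non-port terminals `a, b` scales `Q, I_a, I_b` by `1−l` and
leaves `I_h` unchanged; the port component of `(Q6)` is preserved. [this work] -/
theorem isoSexticPort_edge_ab {Q A B C l : ℝ} (hl1 : l ≤ 1) (h : Q ^ 6 ≤ A ^ 3 * B ^ 3 * C ^ 2) :
    ((1 - l) * Q) ^ 6 ≤ ((1 - l) * A) ^ 3 * ((1 - l) * B) ^ 3 * C ^ 2 := by
  have hm : 0 ≤ (1 - l) ^ 6 := pow_nonneg (sub_nonneg.2 hl1) 6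
  calc ((1 - l) * Q) ^ 6 = (1 - l) ^ 6 * Q ^ 6 := by ring
    _ ≤ (1 - l) ^ 6 * (A ^ 3 * B ^ 3 * C ^ 2) := mul_le_mul_of_nonneg_left h hm
    _ = ((1 - l) * A) ^ 3 * ((1 - l) * B) ^ 3 * C ^ 2 := by ring

/-- A terminal–terminal edge of probability `l` between the port `h` and the terminal `a` scales `Q, I_a, I_h` by `1−l` and leaves
`I_b` unchanged; the port component of `(Q6)` is preserved (with room: `(1−l)⁶ ≤ (1−l)⁵`). [this work] -/
theorem isoSexticPort_edge_ah {Q A B C l : ℝ} (hl0 : 0 ≤ l) (hl1 : l ≤ 1)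
    (h : Q ^ 6 ≤ A ^ 3 * B ^ 3 * C ^ 2) :
    ((1 - l) * Q) ^ 6 ≤ ((1 - l) * A) ^ 3 * B ^ 3 * ((1 - l) * C) ^ 2 := by
  have hm1 : 0 ≤ 1 - l := sub_nonneg.2 hl1
  have h65 : (1 - l) ^ 6 ≤ (1 - l) ^ 5 := by
    have : (1 - l) ^ 6 = (1 - l) ^ 5 * (1 - l) := by ring
    rw [this]
    exact mul_le_of_le_one_right (pow_nonneg hm1 5) (by linarith)
  calc ((1 - l) * Q) ^ 6 = (1 - l) ^ 6 * Q ^ 6 := by ring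
    _ ≤ (1 - l) ^ 5 * (A ^ 3 * B ^ 3 * C ^ 2) := mul_le_mul h65 h (by positivity) (pow_nonneg hm1 5)
    _ = ((1 - l) * A) ^ 3 * B ^ 3 * ((1 - l) * C) ^ 2 := by ring

end Summit.CriticalPhenomena.PercolationContinuityZ3.Theorems.ThreePointIsoSexticPendantConvex
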